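import Mathlib
import HarnessLib
import Summits.NavierStokesRegularity.NavierStokesRegularity.Theorems.CompletionRelayChainDefs
import Summits.NavierStokesRegularity.NavierStokesRegularity.Theorems.CompletionRelayChainPhaseISoundMain
import Summits.NavierStokesRegularity.NavierStokesRegularity.Theorems.CompletionRelayChainPhaseIShell2
import Summits.NavierStokesRegularity.NavierStokesRegularity.Theorems.CompletionRelayChainPhaseIRunAll

/-!
# Route `CompletionRelayChain` — crux `RelayFrontStep` (stmt-NavierStokesRegularity-24850), LINE `window_v2`:
  the registered stub `stub_phaseI` (PHASE I OF THE FRONT-BLOCK CERTIFICATE), PROVED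

Composition of the K-lane: the self-integrating Phase-I checker (`…PhaseIChecker`, p627039) PASSES on all 96 grid cells
(`cells_all`, from the computational data modules `…PhaseIRun00–40` replayed by `native_decide`), the checker is SOUND
(`phaseI_main`: TM arithmetic K1/TMOps, generic enclosure algebra + jets, the signed/history step theorem, the disturbance
bound, the node invariant and its propagation, start containment, footer read-out), and the shell-2 energy bound
(`shell2Bound`, energy identity + Gronwall).  COMPUTATIONAL (inherits the data modules' `native_decide` axioms).
MODEL-lattice bookkeeping (rung TL-M3-R64): a statement about Tao-type restarted pseudo-flows of one finite-dimensional
cascade table; NOTHING here is a statement about the Navier–Stokes equations (the crux `RelayFrontStep` itself closes only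
together with `stub_ignition`).
-/

noncomputable section

set_option linter.dupNamespace false

open Set Literature.Analysis.FluidPDE Literature.Analysis.FluidPDE.TaoCascade

namespace Summit.NavierStokesRegularity.NavierStokesRegularity.Cruxes.RelayFrontStep.Window2

/-- **STUB `stub_phaseI` (LINE `window_v2` v7) — PROVED.** Along every admissible `(η,η)`-pseudo-flow from a `W₃`-state, at
`T* = 147/64` the 18 block amplitudes and the shell energies lie in `PhaseIEndBox`, the Phase-I envelope holds on `[0,T*]`,
the per-mode energies of old shells `0,1,2` stay under `relayEnv₂`, and `∫₀^T* u₂² ≤ ι₁`, `∫₀^T*|r₂u₂| ≤ ι₂` — by the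
kernel-replayed self-integrating Taylor-model checker and its soundness theorem. [this file; computational] -/
theorem stub_phaseI :
  ∀ α : Fin 4 → Fin 4 → Fin 4 → ℤ × ℤ × ℤ → ℝ, InTableClass 64 α → RelayRows α →
    ∀ (τ : ℝ) (S₀ F₀ B₀ : Fin 4 → ℤ → ℝ) (S F : Fin 4 → ℤ → ℝ → ℝ), RelayWindow₃ S₀ F₀ →
      (∀ i k, 0 ≤ B₀ i k) →
      (∀ i, B₀ i (-3) ≤ 28 / 10 ^ 6) → (∀ i, B₀ i (-2) ≤ 14 / 10 ^ 6) → (∀ i, B₀ i (-1) ≤ 7 / 10 ^ 6) →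
      (∀ i, B₀ i 0 ≤ 35 / 10 ^ 7) → (∀ i, B₀ i 1 ≤ 18 / 10 ^ 7) → (∀ i, B₀ i 2 ≤ 9 / 10 ^ 7) →
      8 ≤ τ → PseudoFlowOn τ 1 α (1 / 10 ^ 8) (1 / 10 ^ 8) S₀ F₀ B₀ S F →
      (∀ t ∈ Icc (0 : ℝ) τ, t ≤ 8 → (∫ s in (0 : ℝ)..t, S 1 2 s ^ 2) ≤ 1 / 10 ^ 11 →
        (∫ s in (0 : ℝ)..t, |S 2 2 s * S 1 2 s|) ≤ 1 / 10 ^ 13 →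
          ∀ s ∈ Icc (0 : ℝ) t, ∑ i, F i 3 s ≤ 6 / 10 ^ 20) →
      (∀ s ∈ Icc (0 : ℝ) τ, s ≤ 8 → ∑ i, F i (-4) s ≤ (1 + s / 20) * wakeS (-4)) →
      (∀ s ∈ Icc (0 : ℝ) τ, s ≤ 8 → ∀ k : ℤ, -3 ≤ k → ∑ i, F i k s ≤ 5 / 2) →
      PhaseIEndBox S F ∧ PhaseIEnvelope S ∧
        (∀ s ∈ Icc (0 : ℝ) Tstar, ∀ (i : Fin 4) (k : ℤ), 0 ≤ k → k ≤ 2 → i ≠ 3 → F i k s ≤ relayEnv₂ k) ∧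
        (∫ s in (0 : ℝ)..Tstar, S 1 2 s ^ 2) ≤ iota₁ ∧
        (∫ s in (0 : ℝ)..Tstar, |S 2 2 s * S 1 2 s|) ≤ iota₂ := by
  intro α hE hrows τ S₀ F₀ B₀ S F hW hB0 hBm3 hBm2 hBm1 hB00 hB1 hB2 hτ hflow hT hW4 hA
  have H : PhaseI.Hyps α τ S₀ F₀ B₀ S F :=
    ⟨hE, hrows, hW, hB0, hBm3, hBm2, hBm1, hB00, hB1, hB2, hτ, hflow, hT, hW4, hA⟩
  exact PhaseI.phaseI_main H (PhaseI.shell2Bound H) PhaseI.Checker.cells_all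

end Summit.NavierStokesRegularity.NavierStokesRegularity.Cruxes.RelayFrontStep.Window2

end
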